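import Summits.AtomisticToContinuum.Crystallization.Theses.OneCentreSteepnessLadder
import Literature.MathematicalPhysics.StatisticalMechanics.Yuhjtman2015Proofs
import HarnessLib

/-!
# Line `birth` for crux `OneCentreDominationLJ` (stmt-AtomisticToContinuum-12882) — birth skeleton (BC3)

Crux (route `OneCentreSteepnessLadder`, rank 0, auto-crux = the route's X at `q = 6`): there are
`δ > 0` separating all Lennard-Jones ground states and an hcp scale `(a, h)` in the window
`2/3 < h/a < 5/6` such that for every `η` some gain `γ(η) > 0`, and for every `ε, R₀` some radius
`R ≥ R₀` and ONE local antisymmetric range-`R` transfer rule `g`, give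
`Φ^{≤R}_S(x) + T_g(x) ≤ Φ_hcp(a,h) + ε` at every centre `x` of every `δ`-separated `S ⊂ ℝ³`, improved by
`γ` whenever the closed `(5a/3)`-ball around `x` is not `η`-matched to the `hcp(a,h)` site environment
(`φ₆(r) = 2r⁻⁶ − r⁻¹²`, `Φ_hcp(a,h) = Σ'_{p ∈ hcpStacking a h} φ₆ ‖p‖`, an infinite lattice sum).

## The line: PIN THE TEMPLATE, MAKE BOTH SIDES FINITE-RANGE, SEPARATE BY YUHJTMAN

The crux mixes four things of very different status: (i) WHICH hcp scale `(a, h)` — forced: summing the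
domination inequality over a large block of `hcpStacking a' h'` (transfers cancel) shows `(a, h)` must
maximise the lattice sum `Φ_hcp`, so the template is the RELAXED LENNARD-JONES hcp and nothing else;
(ii) WHICH `δ` — any proved lower bound on interparticle distances of LJ ground states will do, and the
tree PROVES `0.684` (`Yuhjtman2015_minDistance_holds`, Yuhjtman 2015 Cor. 7); (iii) two TAILS — the
truncation error of the one-centre sum, uniform over separated sets (`q = 6 > 3`), and the convergence
of the truncated hcp lattice sum to `Φ_hcp`; (iv) the genuinely open FINITE-RANGE COERCIVE DOMINATION
at the optimal template.  The skeleton files (i), (iii), (iv) as stubs and discharges (ii) and all the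
glue in the kernel-checked composition:

* `stub_hcpOptimalScale` (M/L; true by continuity + coercivity of the two-parameter lattice sum and a
  certified evaluation; numerics: nearest-neighbour scale `a* = 0.9712`, `h*/a* = 0.8165 = √(2/3)` to
  scan resolution, `Φ_hcp = 14.4549²/12.1323 = 17.2222`, refuter g44-36 evidence `LatticeSums.py` on the
  crux item) — SOME `(a, h)` INSIDE the window maximises `Φ_hcp(a', h')` over all `a', h' > 0`.
* `stub_coreDomination` (XL; the open heart, = the crux's mechanism and why-might-fail) — for EVERY
  such maximiser: coercive one-centre domination over `0.684`-separated sets with BOTH sides truncated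
  at the same radius `ρ` (`∀ ε ∀ ρ₀ ∃ ρ ≥ ρ₀`: the one-centre sum within `ρ` plus the transfer is at most
  the hcp lattice sum WITHIN `ρ` plus `ε`, minus `γ(η)` at `η`-defective centres), the rule `g` having
  its own range/view radius `R₁` (decoupled from `ρ`: a rule that reads neighbours' shells needs
  `R₁ > ρ`).  No ground states, no infinite sum on the right, template pinned by a variational
  characterisation instead of three existential reals.
* `stub_uniformTail` (M; true, shell counting as in the tree's finite-configuration lemma
  `sum_phi_le_sum_ite_add`: `0 ≤ Φ^{≤R}_S(x) − Φ^{≤ρ}_S(x) ≤ 2048/(δ³ρ³)` for `1 ≤ ρ ≤ R`) — for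
  `δ`-separated `S ⊂ ℝ³` (any `δ > 0`), enlarging the truncation radius from `ρ ≥ ρ₀(δ, ε)` to any
  `R ≥ ρ` adds at most `ε`, uniformly in `S` and the centre.
* `stub_hcpTail` (S/M; true: `hcpStacking a h` is uniformly discrete (`le_dist_of_mem_barlowStacking`),
  `φ₆ ∘ ‖·‖` is summable on it and the truncations converge) — `Φ_hcp^{≤ρ}(a,h) ≤ Φ_hcp(a,h) + ε` for
  `ρ ≥ ρ₀(a, h, ε)`.
* `OneCentreDominationLJ_of` — the composition (no `sorry` outside `stub_*`): `(a, h)` from the first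
  stub; `δ := 0.684` with LJ separation from `Yuhjtman2015_minDistance_holds`; given `η` take `γ` from
  the core; given `ε, R₀` take `ρ₁ = ρ₀(0.684, ε/3)` (tail), `ρ₂ = ρ₀(a, h, ε/3)` (hcp tail), the core's
  `ρ ≥ max ρ₁ ρ₂`, `R₁`, `g` at `ε/3`, and set `R := max (max R₀ ρ) R₁`,
  `g' v U := g v (U ∩ closedBall 0 R₁)` (RESTRICT THE VIEW: `g'` has range `≤ R₁ ≤ R`, and on every
  `S` its `R`-views restrict to the `R₁`-views, so antisymmetry and the transfer sums are those of `g`);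
  then `Φ^{≤R} + T_{g'} ≤ (Φ^{≤ρ} + ε/3) + T_g ≤ Φ_hcp^{≤ρ} + 2ε/3 ≤ Φ_hcp + ε`, and `− γ` at defective
  centres.

Why this is not the crux re-packaged: `stub_coreDomination` is strictly finite-range on both sides and
is stated for an (a priori unknown) VARIATIONAL template — proving it forces the prover through the
properties of maximisers of `Φ_hcp`, which is where the `q = 6` numerics (17.2222 vs fcc 17.2204,
first shell 11.56 at `a*`) legitimately enter; the other three stubs are theorems-to-be of independent
use (the tail lemma is the `tsum`/infinite-`S` form of the bookkeeping already proved for finite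
clusters in `OneCentreSteepnessLadderZeroDensityOfDefectsBookkeeping`).  The constant `0.684` is the
weakest separation the tree can glue today; a better proved LJ separation `s` replaces it verbatim
(weaker core stub, same composition).

Disproof.lean: none exists for this crux (`ledger crux ls stmt-AtomisticToContinuum-12882`: no
workfiles, 2026-08-17).  Negatives index (`ledger negatives --problem AtomisticToContinuum`, 20 entries,
4 in this sub) checked: 15929 `ShellCensus` / 4146 `EffectiveLocalHales` (first-shell censuses of
near-unit twelve-codes — no shell alphabet is asserted here: matching is metric, of whole closed
`5a/3`-balls, and only in the coercive clause), 17253 `OneMultiplierPricing` (pricing LINEAR in a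
mismatch parameter, killed by dilated ground states — the core prices ONE tolerance `η` by an
existential `γ(η)` and compares against the Φ_hcp-OPTIMAL template, so dilates of hcp are legitimately
defective and cost `O(dilation²)·N`, consistent with `γ(η) → 0`), 3506 `OneGrainGluing` (multiplicity
pile-up on non-injective configurations — all stubs speak of separated point SETS).  The core keeps the
crux's `∀ ε ∃ ρ(ε)` order (a single-radius exact version is false: the `Φ^{≤ρ}`-optimal hcp scale
differs from the `Φ`-optimal one by `O(ρ⁻³)`).

BC3 probes (registrar's folder `bc/probe_*.lean`, `bc/probe2_*.lean`; farm, `maxHeartbeats 400000`):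
for each stub `S`, `example : S → OneCentreDominationLJ` and `example : S → _root_.Crystallization` by
`first | exact? | simpa | aesop` FAIL (8/8 rc 1: `exact?` "could not close the goal", `simpa` type
mismatch, `aesop` "failed to prove the goal after exhaustive search" — for `stub_coreDomination` aesop
exhausts the heartbeat budget normalising the hypothesis instead).
-/

namespace Summit.AtomisticToContinuum.Crystallization.Cruxes.OneCentreDominationLJ.Birth

open scoped BigOperators

/-! ## Registered stubs (sorries live ONLY here; signatures fully inlined, one line each) -/

/-- **STUB 1 — the relaxed Lennard-Jones hcp template exists inside the window** (size M/L; true).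
Some `a, h > 0` with `2a < 3h`, `6h < 5a` maximise the hcp one-centre lattice sum
`Φ_hcp(a', h') = Σ'_{p ∈ hcpStacking a' h'} (2‖p‖⁻⁶ − ‖p‖⁻¹²)` over all `a', h' > 0`.  Why true:
`Φ_hcp` is continuous on `(0, ∞)²` (locally uniform summability, `q = 6 > 3`), `→ −∞` as `a' → 0` or
`h' → 0` (the `−r⁻¹²` term), tends to the chain / single-layer values `< 7` as `a'` or `h' → ∞`, and
equals `≈ 17.2222` at `(a', h') ≈ (0.9712, 0.9712·√(2/3))`, whose ratio `0.8165` lies in `(2/3, 5/6)`;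
so the supremum is attained, and (certified evaluation) only inside the window.  NECESSARY for the crux:
domination summed over blocks of `hcpStacking a' h'` forces `Φ_hcp(a', h') ≤ Φ_hcp(a, h)`.
Leans on: `hcpStacking`, `le_dist_of_mem_barlowStacking`, `HcpHomogeneous`, `HcpSiteGeometry`. -/
theorem stub_hcpOptimalScale : ∃ a h : ℝ, 0 < a ∧ 0 < h ∧ 2 * a < 3 * h ∧ 6 * h < 5 * a ∧ ∀ a' h' : ℝ, 0 < a' → 0 < h' → (∑' p : ↥(Literature.MathematicalPhysics.StatisticalMechanics.hcpStacking a' h'), (2 * (‖(p : EuclideanSpace ℝ (Fin 3))‖)⁻¹ ^ 6 - (‖(p : EuclideanSpace ℝ (Fin 3))‖)⁻¹ ^ (2 * 6))) ≤ (∑' p : ↥(Literature.MathematicalPhysics.StatisticalMechanics.hcpStacking a h), (2 * (‖(p : EuclideanSpace ℝ (Fin 3))‖)⁻¹ ^ 6 - (‖(p : EuclideanSpace ℝ (Fin 3))‖)⁻¹ ^ (2 * 6))) := by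
  sorry

/-- **STUB 2 — finite-range coercive one-centre domination at the optimal template** (size XL; the
open heart of the crux).  For every window maximiser `(a, h)` of `Φ_hcp`: for every `η > 0` there is
`γ > 0` such that for every `ε > 0` and `ρ₀` there are a truncation radius `ρ ≥ ρ₀`, a rule radius `R₁`
and a rule `g : ℝ³ → Set ℝ³ → ℝ` vanishing on displacements longer than `R₁`, such that on every
`0.684`-separated `S ⊂ ℝ³` the rule is antisymmetric on `R₁`-views and at every `x ∈ S`
`Σ_{y ∈ S, |y−x| ≤ ρ} φ₆(|y−x|) + Σ_{y ∈ S} g(y − x, view_{R₁}(x)) ≤ Σ_{p ∈ hcp(a,h), ‖p‖ ≤ ρ} φ₆(‖p‖) + ε`,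
and `≤ … + ε − γ` when the closed `(5a/3)`-ball of `S` around `x` is not `η`-matched (both ways, up to
a linear isometry) to that of `hcpStacking a h` around `0`.  Why it might fail = the crux's: `q = 6` is
not steep (13-fold centres with bonds in `[1, 1.046]`, Frank–Kasper `Z14` sites and breathing-mode
distortions carry first-shell surplus `≈ 0.4–0.7` against `11.56`; `Φ_hcp − Φ_fcc = 1.8e-3` caps `γ`),
so a finite-range LOCAL rule may fail to collect the compensating deficit.  Plan: strain-linear
transfer `−φ₆′(r) ê·(u_x + u_y)` kills first order at the optimal template (this is where maximality
of `(a, h)` is used), local phonon positivity of hcp gives the near-matched regime, kissing/Tammes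
compactness + deficit sharing at range `2` the far regime.  Leans on: `musin2006_kissing_three_holds`,
`LocalTwelveRigidity` (route crux, rank 2), `HcpSiteGeometry`. -/
theorem stub_coreDomination : ∀ a h : ℝ, 0 < a → 0 < h → 2 * a < 3 * h → 6 * h < 5 * a → (∀ a' h' : ℝ, 0 < a' → 0 < h' → (∑' p : ↥(Literature.MathematicalPhysics.StatisticalMechanics.hcpStacking a' h'), (2 * (‖(p : EuclideanSpace ℝ (Fin 3))‖)⁻¹ ^ 6 - (‖(p : EuclideanSpace ℝ (Fin 3))‖)⁻¹ ^ (2 * 6))) ≤ (∑' p : ↥(Literature.MathematicalPhysics.StatisticalMechanics.hcpStacking a h), (2 * (‖(p : EuclideanSpace ℝ (Fin 3))‖)⁻¹ ^ 6 - (‖(p : EuclideanSpace ℝ (Fin 3))‖)⁻¹ ^ (2 * 6)))) → ∀ η : ℝ, 0 < η → ∃ γ : ℝ, 0 < γ ∧ ∀ ε : ℝ, 0 < ε → ∀ ρ₀ : ℝ, ∃ ρ : ℝ, ρ₀ ≤ ρ ∧ ∃ R₁ : ℝ, ∃ g : EuclideanSpace ℝ (Fin 3) → Set (EuclideanSpace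 ℝ (Fin 3)) → ℝ, (∀ (v : EuclideanSpace ℝ (Fin 3)) (U : Set (EuclideanSpace ℝ (Fin 3))), R₁ < ‖v‖ → g v U = 0) ∧ ∀ S : Set (EuclideanSpace ℝ (Fin 3)), (∀ x ∈ S, ∀ y ∈ S, x ≠ y → (0.684 : ℝ) ≤ dist x y) → (∀ x ∈ S, ∀ y ∈ S, g (y - x) (((fun z : EuclideanSpace ℝ (Fin 3) => z - x) '' S) ∩ Metric.closedBall (0 : EuclideanSpace ℝ (Fin 3)) R₁) = - g (x - y) (((fun z : EuclideanSpace ℝ (Fin 3) => z - y) '' S) ∩ Metric.closedBall (0 : EuclideanSpace ℝ (Fin 3)) R₁)) ∧ ∀ x ∈ S, ((∑' y : ↥S, (if dist x (y : EuclideanSpace ℝ (Fin 3)) ≤ ρ then (2 * (dist x (y : EuclideanSpace ℝ (Fin 3)))⁻¹ ^ 6 - (dist x (y : EuclideanSpace ℝ (Fin 3)))⁻¹ ^ (2 * 6)) else 0)) + (∑' y : ↥S, g ((y : EuclideanSpace ℝ (Fin 3)) - x) (((fun z : EuclideanSpace ℝ (Fin 3) => z - x) '' S) ∩ Metric.closedBall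 (0 : EuclideanSpace ℝ (Fin 3)) R₁)) ≤ (∑' p : ↥(Literature.MathematicalPhysics.StatisticalMechanics.hcpStacking a h), (if ‖(p : EuclideanSpace ℝ (Fin 3))‖ ≤ ρ then (2 * (‖(p : EuclideanSpace ℝ (Fin 3))‖)⁻¹ ^ 6 - (‖(p : EuclideanSpace ℝ (Fin 3))‖)⁻¹ ^ (2 * 6)) else 0)) + ε) ∧ (¬ (∃ A : EuclideanSpace ℝ (Fin 3) →ₗᵢ[ℝ] EuclideanSpace ℝ (Fin 3), (∀ p ∈ Literature.MathematicalPhysics.StatisticalMechanics.hcpStacking a h, ‖p‖ ≤ 5 / 3 * a → ∃ y ∈ S, dist y (x + A p) ≤ η) ∧ (∀ y ∈ S, dist y x ≤ 5 / 3 * a → ∃ p ∈ Literature.MathematicalPhysics.StatisticalMechanics.hcpStacking a h, dist y (x + A p) ≤ η)) → (∑' y : ↥S, (if dist x (y : EuclideanSpace ℝ (Fin 3)) ≤ ρ then (2 * (dist x (y : EuclideanSpace ℝ (Fin 3)))⁻¹ ^ 6 - (dist x (y : EuclideanSpace ℝ (Fin 3)))⁻¹ ^ (2 * 6)) else 0))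 + (∑' y : ↥S, g ((y : EuclideanSpace ℝ (Fin 3)) - x) (((fun z : EuclideanSpace ℝ (Fin 3) => z - x) '' S) ∩ Metric.closedBall (0 : EuclideanSpace ℝ (Fin 3)) R₁)) ≤ (∑' p : ↥(Literature.MathematicalPhysics.StatisticalMechanics.hcpStacking a h), (if ‖(p : EuclideanSpace ℝ (Fin 3))‖ ≤ ρ then (2 * (‖(p : EuclideanSpace ℝ (Fin 3))‖)⁻¹ ^ 6 - (‖(p : EuclideanSpace ℝ (Fin 3))‖)⁻¹ ^ (2 * 6)) else 0)) + ε - γ) := by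
  sorry

/-- **STUB 3 — uniform truncation tail over separated sets** (size M; true).  For `δ > 0` and
`ε > 0` there is `ρ₀` such that for all `ρ₀ ≤ ρ ≤ R`, every `δ`-separated `S ⊂ ℝ³` and every `x ∈ S`,
the one-centre sum truncated at `R` exceeds the one truncated at `ρ` by at most `ε`.  Why true: both
sums are finitely supported (a `δ`-separated set meets a ball in `≤ (2R/δ + 1)³` points), the added
terms have `ρ < |y − x| ≤ R`, are `≤ 2|y−x|⁻⁶`, and dyadic shell counting gives
`Σ_{|y−x| > ρ} 2|y−x|⁻⁶ ≤ 2048/(δ³ρ³)` (`ρ ≥ max(δ,1)`), exactly as in the tree's finite-cluster lemma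
`Summit…Theorems.sum_phi_le_sum_ite_add` (`q = 6`).  Leans on: that lemma's proof
(`sum_inv_pow_le_of_separated`), `tsum_eq_sum` on finite supports. -/
theorem stub_uniformTail : ∀ δ : ℝ, 0 < δ → ∀ ε : ℝ, 0 < ε → ∃ ρ₀ : ℝ, ∀ ρ R : ℝ, ρ₀ ≤ ρ → ρ ≤ R → ∀ S : Set (EuclideanSpace ℝ (Fin 3)), (∀ x ∈ S, ∀ y ∈ S, x ≠ y → δ ≤ dist x y) → ∀ x ∈ S, (∑' y : ↥S, (if dist x (y : EuclideanSpace ℝ (Fin 3)) ≤ R then (2 * (dist x (y : EuclideanSpace ℝ (Fin 3)))⁻¹ ^ 6 - (dist x (y : EuclideanSpace ℝ (Fin 3)))⁻¹ ^ (2 * 6)) else 0)) ≤ (∑' y : ↥S, (if dist x (y : EuclideanSpace ℝ (Fin 3)) ≤ ρ then (2 * (dist x (y : EuclideanSpace ℝ (Fin 3)))⁻¹ ^ 6 - (dist x (y : EuclideanSpace ℝ (Fin 3)))⁻¹ ^ (2 * 6)) else 0)) + ε := by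
  sorry

/-- **STUB 4 — the truncated hcp lattice sum converges from below up to `ε`** (size S/M; true).
For `a, h > 0` and `ε > 0` there is `ρ₀` with `Σ'_{p ∈ hcp(a,h), ‖p‖ ≤ ρ} φ₆ ‖p‖ ≤ Φ_hcp(a,h) + ε` for
all `ρ ≥ ρ₀`.  Why true: `hcpStacking a h` is `min(a, h)`-separated (`le_dist_of_mem_barlowStacking`),
so `p ↦ φ₆ ‖p‖` is summable on it (`q = 6 > 3`) and the truncations converge to the `tsum`
(`(Summable).tendsto_…` over the exhaustion by balls; beyond `‖p‖ ≥ 1` the omitted terms are even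
nonnegative).  Leans on: `HcpHomogeneous` / `PeriodicConfigurationSums` summability API. -/
theorem stub_hcpTail : ∀ a h : ℝ, 0 < a → 0 < h → ∀ ε : ℝ, 0 < ε → ∃ ρ₀ : ℝ, ∀ ρ : ℝ, ρ₀ ≤ ρ → (∑' p : ↥(Literature.MathematicalPhysics.StatisticalMechanics.hcpStacking a h), (if ‖(p : EuclideanSpace ℝ (Fin 3))‖ ≤ ρ then (2 * (‖(p : EuclideanSpace ℝ (Fin 3))‖)⁻¹ ^ 6 - (‖(p : EuclideanSpace ℝ (Fin 3))‖)⁻¹ ^ (2 * 6)) else 0)) ≤ (∑' p : ↥(Literature.MathematicalPhysics.StatisticalMechanics.hcpStacking a h), (2 * (‖(p : EuclideanSpace ℝ (Fin 3))‖)⁻¹ ^ 6 - (‖(p : EuclideanSpace ℝ (Fin 3))‖)⁻¹ ^ (2 * 6))) + ε := by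
  sorry

/-! ## The composition (kernel-checked, no `sorry` outside the stubs) -/

/-- **`OneCentreDominationLJ` from the four stub STATEMENTS** (taken as hypotheses, so that the
registered stubs are exactly the open obligations; the conclusion is the route decl BY NAME).
`(a, h)` := the maximiser of stub 1; `δ := 0.684` with Lennard-Jones separation from the PROVED
`Yuhjtman2015_minDistance_holds`; `γ(η)` from stub 2; for `ε, R₀`: tails at `ε/3`, the core at `ε/3`
with `ρ ≥ max ρ₁ ρ₂`, `R := max (max R₀ ρ) R₁`, and the VIEW-RESTRICTED rule
`g' v U := g v (U ∩ closedBall 0 R₁)`. -/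
theorem OneCentreDominationLJ_of : (∃ a h : ℝ, 0 < a ∧ 0 < h ∧ 2 * a < 3 * h ∧ 6 * h < 5 * a ∧ ∀ a' h' : ℝ, 0 < a' → 0 < h' → (∑' p : ↥(Literature.MathematicalPhysics.StatisticalMechanics.hcpStacking a' h'), (2 * (‖(p : EuclideanSpace ℝ (Fin 3))‖)⁻¹ ^ 6 - (‖(p : EuclideanSpace ℝ (Fin 3))‖)⁻¹ ^ (2 * 6))) ≤ (∑' p : ↥(Literature.MathematicalPhysics.StatisticalMechanics.hcpStacking a h), (2 * (‖(p : EuclideanSpace ℝ (Fin 3))‖)⁻¹ ^ 6 - (‖(p : EuclideanSpace ℝ (Fin 3))‖)⁻¹ ^ (2 * 6)))) → (∀ a h : ℝ, 0 < a → 0 < h → 2 * a < 3 * h → 6 * h < 5 * a → (∀ a' h' : ℝ, 0 < a' → 0 < h' → (∑' p : ↥(Literature.MathematicalPhysics.StatisticalMechanics.hcpStacking a' h'), (2 * (‖(p : EuclideanSpace ℝ (Fin 3))‖)⁻¹ ^ 6 - (‖(p : EuclideanSpace ℝ (Fin 3))‖)⁻¹ ^ (2 * 6))) ≤ (∑' p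 : ↥(Literature.MathematicalPhysics.StatisticalMechanics.hcpStacking a h), (2 * (‖(p : EuclideanSpace ℝ (Fin 3))‖)⁻¹ ^ 6 - (‖(p : EuclideanSpace ℝ (Fin 3))‖)⁻¹ ^ (2 * 6)))) → ∀ η : ℝ, 0 < η → ∃ γ : ℝ, 0 < γ ∧ ∀ ε : ℝ, 0 < ε → ∀ ρ₀ : ℝ, ∃ ρ : ℝ, ρ₀ ≤ ρ ∧ ∃ R₁ : ℝ, ∃ g : EuclideanSpace ℝ (Fin 3) → Set (EuclideanSpace ℝ (Fin 3)) → ℝ, (∀ (v : EuclideanSpace ℝ (Fin 3)) (U : Set (EuclideanSpace ℝ (Fin 3))), R₁ < ‖v‖ → g v U = 0) ∧ ∀ S : Set (EuclideanSpace ℝ (Fin 3)), (∀ x ∈ S, ∀ y ∈ S, x ≠ y → (0.684 : ℝ) ≤ dist x y) → (∀ x ∈ S, ∀ y ∈ S, g (y - x) (((fun z : EuclideanSpace ℝ (Fin 3) => z - x) '' S) ∩ Metric.closedBall (0 : EuclideanSpace ℝ (Fin 3)) R₁) = - g (x - y) (((fun z : EuclideanSpace ℝ (Fin 3) => z - y)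 '' S) ∩ Metric.closedBall (0 : EuclideanSpace ℝ (Fin 3)) R₁)) ∧ ∀ x ∈ S, ((∑' y : ↥S, (if dist x (y : EuclideanSpace ℝ (Fin 3)) ≤ ρ then (2 * (dist x (y : EuclideanSpace ℝ (Fin 3)))⁻¹ ^ 6 - (dist x (y : EuclideanSpace ℝ (Fin 3)))⁻¹ ^ (2 * 6)) else 0)) + (∑' y : ↥S, g ((y : EuclideanSpace ℝ (Fin 3)) - x) (((fun z : EuclideanSpace ℝ (Fin 3) => z - x) '' S) ∩ Metric.closedBall (0 : EuclideanSpace ℝ (Fin 3)) R₁)) ≤ (∑' p : ↥(Literature.MathematicalPhysics.StatisticalMechanics.hcpStacking a h), (if ‖(p : EuclideanSpace ℝ (Fin 3))‖ ≤ ρ then (2 * (‖(p : EuclideanSpace ℝ (Fin 3))‖)⁻¹ ^ 6 - (‖(p : EuclideanSpace ℝ (Fin 3))‖)⁻¹ ^ (2 * 6)) else 0)) + ε) ∧ (¬ (∃ A : EuclideanSpace ℝ (Fin 3) →ₗᵢ[ℝ] EuclideanSpace ℝ (Fin 3), (∀ p ∈ Literature.MathematicalPhysics.StatisticalMechanics.hcpStacking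 a h, ‖p‖ ≤ 5 / 3 * a → ∃ y ∈ S, dist y (x + A p) ≤ η) ∧ (∀ y ∈ S, dist y x ≤ 5 / 3 * a → ∃ p ∈ Literature.MathematicalPhysics.StatisticalMechanics.hcpStacking a h, dist y (x + A p) ≤ η)) → (∑' y : ↥S, (if dist x (y : EuclideanSpace ℝ (Fin 3)) ≤ ρ then (2 * (dist x (y : EuclideanSpace ℝ (Fin 3)))⁻¹ ^ 6 - (dist x (y : EuclideanSpace ℝ (Fin 3)))⁻¹ ^ (2 * 6)) else 0)) + (∑' y : ↥S, g ((y : EuclideanSpace ℝ (Fin 3)) - x) (((fun z : EuclideanSpace ℝ (Fin 3) => z - x) '' S) ∩ Metric.closedBall (0 : EuclideanSpace ℝ (Fin 3)) R₁)) ≤ (∑' p : ↥(Literature.MathematicalPhysics.StatisticalMechanics.hcpStacking a h), (if ‖(p : EuclideanSpace ℝ (Fin 3))‖ ≤ ρ then (2 * (‖(p : EuclideanSpace ℝ (Fin 3))‖)⁻¹ ^ 6 - (‖(p : EuclideanSpace ℝ (Fin 3))‖)⁻¹ ^ (2 * 6)) else 0)) + ε - γ)) → (∀ δ : ℝ, 0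 < δ → ∀ ε : ℝ, 0 < ε → ∃ ρ₀ : ℝ, ∀ ρ R : ℝ, ρ₀ ≤ ρ → ρ ≤ R → ∀ S : Set (EuclideanSpace ℝ (Fin 3)), (∀ x ∈ S, ∀ y ∈ S, x ≠ y → δ ≤ dist x y) → ∀ x ∈ S, (∑' y : ↥S, (if dist x (y : EuclideanSpace ℝ (Fin 3)) ≤ R then (2 * (dist x (y : EuclideanSpace ℝ (Fin 3)))⁻¹ ^ 6 - (dist x (y : EuclideanSpace ℝ (Fin 3)))⁻¹ ^ (2 * 6)) else 0)) ≤ (∑' y : ↥S, (if dist x (y : EuclideanSpace ℝ (Fin 3)) ≤ ρ then (2 * (dist x (y : EuclideanSpace ℝ (Fin 3)))⁻¹ ^ 6 - (dist x (y : EuclideanSpace ℝ (Fin 3)))⁻¹ ^ (2 * 6)) else 0)) + ε) → (∀ a h : ℝ, 0 < a → 0 < h → ∀ ε : ℝ, 0 < ε → ∃ ρ₀ : ℝ, ∀ ρ : ℝ, ρ₀ ≤ ρ → (∑' p : ↥(Literature.MathematicalPhysics.StatisticalMechanics.hcpStacking a h), (if ‖(p : EuclideanSpace ℝ (Fin 3))‖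 ≤ ρ then (2 * (‖(p : EuclideanSpace ℝ (Fin 3))‖)⁻¹ ^ 6 - (‖(p : EuclideanSpace ℝ (Fin 3))‖)⁻¹ ^ (2 * 6)) else 0)) ≤ (∑' p : ↥(Literature.MathematicalPhysics.StatisticalMechanics.hcpStacking a h), (2 * (‖(p : EuclideanSpace ℝ (Fin 3))‖)⁻¹ ^ 6 - (‖(p : EuclideanSpace ℝ (Fin 3))‖)⁻¹ ^ (2 * 6))) + ε) → Summit.AtomisticToContinuum.Crystallization.Theses.OneCentreSteepnessLadder.OneCentreDominationLJ := by
  intro hopt hcore htail hhcp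
  obtain ⟨a, h, ha, hh, hw₁, hw₂, hmax⟩ := hopt
  refine ⟨(0.684 : ℝ), a, h, by norm_num, ha, hh, hw₁, hw₂, ?_, ?_⟩
  · -- Lennard-Jones ground states are `0.684`-separated (Yuhjtman 2015, Cor. 7; PROVED in tree)
    intro N x hx i j hij
    exact (Literature.MathematicalPhysics.StatisticalMechanics.Yuhjtman2015_minDistance_holds
      N x hx i j hij).le
  · intro η hη
    obtain ⟨γ, hγ, hcoreγ⟩ := hcore a h ha hh hw₁ hw₂ hmax η hη
    refine ⟨γ, hγ, ?_⟩
    intro ε hε R₀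
    have hε3 : (0 : ℝ) < ε / 3 := by linarith
    -- the two tails at `ε / 3`
    obtain ⟨ρ₁, htail₁⟩ := htail (0.684 : ℝ) (by norm_num) (ε / 3) hε3
    obtain ⟨ρ₂, hhcp₂⟩ := hhcp a h ha hh (ε / 3) hε3
    -- the core at `ε / 3`, truncation radius beyond both tail thresholds
    obtain ⟨ρ, hρ, R₁, g, hrange, hS⟩ := hcoreγ (ε / 3) hε3 (max ρ₁ ρ₂)
    have hρ₁ : ρ₁ ≤ ρ := le_trans (le_max_left _ _) hρ
    have hρ₂ : ρ₂ ≤ ρ := le_trans (le_max_right _ _) hρ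
    -- the crux's single radius `R := max (max R₀ ρ) R₁` (truncation = view = range) and the
    -- VIEW-RESTRICTED rule `g' v U := g v (U ∩ closedBall 0 R₁)`
    have hR₀R : R₀ ≤ max (max R₀ ρ) R₁ := le_trans (le_max_left _ _) (le_max_left _ _)
    have hρR : ρ ≤ max (max R₀ ρ) R₁ := le_trans (le_max_right _ _) (le_max_left _ _)
    have hR₁R : R₁ ≤ max (max R₀ ρ) R₁ := le_max_right _ _
    refine ⟨max (max R₀ ρ) R₁, hR₀R,
      fun v U => g v (U ∩ Metric.closedBall (0 : EuclideanSpace ℝ (Fin 3)) R₁), ?_, ?_⟩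
    · -- range: `g'` vanishes beyond `R ≥ R₁`
      intro v U hv
      exact hrange v _ (lt_of_le_of_lt hR₁R hv)
    · intro S hsep
      obtain ⟨hanti, hpt⟩ := hS S hsep
      -- restricting an `R`-view to radius `R₁ ≤ R` gives the `R₁`-view
      have hview : ∀ z : EuclideanSpace ℝ (Fin 3),
          ((fun w : EuclideanSpace ℝ (Fin 3) => w - z) '' S ∩
              Metric.closedBall (0 : EuclideanSpace ℝ (Fin 3)) (max (max R₀ ρ) R₁)) ∩
            Metric.closedBall (0 : EuclideanSpace ℝ (Fin 3)) R₁ =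
          (fun w : EuclideanSpace ℝ (Fin 3) => w - z) '' S ∩
            Metric.closedBall (0 : EuclideanSpace ℝ (Fin 3)) R₁ := by
        intro z
        rw [Set.inter_assoc, Set.inter_eq_right.mpr (Metric.closedBall_subset_closedBall hR₁R)]
      refine ⟨?_, ?_⟩
      · -- antisymmetry of `g'` on `R`-views = antisymmetry of `g` on `R₁`-views
        intro x hx y hy
        show g (y - x) (_ ∩ _) = - g (x - y) (_ ∩ _)
        rw [hview x, hview y]
        exact hanti x hx y hy
      · intro x hx
        obtain ⟨h₁, h₂⟩ := hpt x hx
        -- tail of the configuration sum and of the hcp lattice sum, both at `ε / 3`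
        have ht := htail₁ ρ (max (max R₀ ρ) R₁) hρ₁ hρR S hsep x hx
        have hH := hhcp₂ ρ hρ₂
        -- the transfer of `g'` read on `R`-views is the transfer of `g` on `R₁`-views
        have hT : (∑' y : ↥S, (fun v U => g v (U ∩ Metric.closedBall (0 : EuclideanSpace ℝ (Fin 3)) R₁))
            ((y : EuclideanSpace ℝ (Fin 3)) - x)
            (((fun z : EuclideanSpace ℝ (Fin 3) => z - x) '' S) ∩
              Metric.closedBall (0 : EuclideanSpace ℝ (Fin 3)) (max (max R₀ ρ) R₁))) =
            ∑' y : ↥S, g ((y : EuclideanSpace ℝ (Fin 3)) - x)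
              (((fun z : EuclideanSpace ℝ (Fin 3) => z - x) '' S) ∩
                Metric.closedBall (0 : EuclideanSpace ℝ (Fin 3)) R₁) := by
          refine tsum_congr fun y => ?_
          show g _ (_ ∩ _) = _
          rw [hview x]
        rw [hT]
        exact ⟨by linarith, fun hnm => by linarith [h₂ hnm]⟩

/-- **The crux BY NAME from the registered stubs** (the only `sorry`s in its cone are the four `stub_*`). -/
theorem OneCentreDominationLJ_of_stubs : Summit.AtomisticToContinuum.Crystallization.Theses.OneCentreSteepnessLadder.OneCentreDominationLJ :=
  OneCentreDominationLJ_of stub_hcpOptimalScale stub_coreDomination stub_uniformTail stub_hcpTail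

end Summit.AtomisticToContinuum.Crystallization.Cruxes.OneCentreDominationLJ.Birth
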